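import Summits.QuantumFields.YangMills.Theorems.BalabanUVNodesN15KingModelCombesThomasPropagator
import Summits.QuantumFields.YangMills.Theorems.BalabanUVNodesN15KingModelCovariantBlockSmallField
import Summits.QuantumFields.YangMills.Theorems.BalabanUVNodesN15KingModelCovariantLinkDependence
import Summits.QuantumFields.YangMills.Theorems.BalabanUVNodesN15KingModelComplexLinkOperatorNorm
import HarnessLib

/-!
# BalabanUVNodes ∕ N15 — THE KING-MODEL RUNG (PART Ϧ-f): THE RESPONSE OF THE BACKGROUND PROPAGATOR TO THE FIELD IS LOCAL — the second resolvent identity IN THE WEIGHTED ALGEBRA: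
# `e^{φ}(G(U) − G(V))e^{−φ} = (e^{φ}G(U)e^{−φ})·(e^{φ}(A₀(V) − A₀(U))e^{−φ})·(e^{φ}G(V)e^{−φ})`, hence `‖blk (G(U) − G(V)) x y‖ ≤ (κ−ρ)⁻²·‖(A₀(U) − A₀(V))_φ‖·e^{−(κ_w∕L)d(x,y)}` at two
# coercive fields; the weighted norm of the perturbation by the block Schur test: `≤ e^{κ_w∕L}·2(d+1)c·ε + e^{κ_w}·2aD·ε` for `sup_b‖U_b − V_b‖ ≤ ε`
# (Track A, DAG node N15 = NE2; FAN-OUT v1.1 §N15 s3 «KING-MODEL RUNG … + what the curved case adds»; count-neutral)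

EDITION v1.1 (DOC-ONLY, ERRATUM-Ϧ1, 2026-08-31): locators corrected after ref-J READ-769∕770 — [Balaban1985BackgroundPropagators] (3.37) is on p.396 (not p.397) and (3.48)–(3.50) span pp.398–400 (not p.398),
verified first-hand on the held text (journal page = 388 + file page).  Declarations byte-identical to v1.0.

HONEST FRAMING.  Count-neutral (cell `pub-ymgap`, seat `pub-ymgap-dag-n15-e` g50; `--supports stmt-QuantumFields-27247 --as helper` = K3ᴬ, KEY MAP v3).  King's one-level comparison model; unitary link
fields; `ℓ²` OPERATOR currency.  HONEST LIMITATION, stated as a theorem shape and not hidden: the operator norm of `A₀(U) − A₀(V)` carries the Laplacian's coefficient `c = L² = η⁻²`, so the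
Lipschitz constant below is `O(L²ε + aLε)` in King's scaling — `η`-uniform for perturbations `ε = O(η²)` only; the `η`-uniform Lipschitz estimate of [Balaban1985BackgroundPropagators] for
`|U − V| ≤ εη` needs the form-bounded (`H¹`) currency, which is NOT in this file.  What IS decided: the algebra (resolvent identity commutes with the conjugation), the decay of the difference
kernel at the Combes–Thomas rate, and explicit constants.  NOT Bałaban's (3.48)–(3.50); NOT analyticity (PART Ϛ, fine covariance only); NOT a node discharge; nothing continuum ∕ ℝ⁴ ∕ OS ∕ Clay.

THE RESULTS (`T_φ = e^{φ}Te^{−φ}` = PART Ϧ-a `wtConj`; `A₀(U) = fullOpU`; `G(U) = A₀(U)⁻¹`):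
* §1 (any torus, any matrices) `inv_sub_inv_eq` (`T⁻¹ − S⁻¹ = T⁻¹(S − T)S⁻¹` for invertible `T, S`), ★ `wtConj_inv_sub_inv` (the same identity conjugated), ★★ `norm_wtConj_inv_sub_inv_le`
  (`‖(T⁻¹ − S⁻¹)_φ‖ ≤ ‖T⁻¹_φ‖·‖(S − T)_φ‖·‖S⁻¹_φ‖`), ★★★ **`norm_blk_inv_sub_inv_le_of_conjCoercive`** (both `T_φ`, `S_φ` `γ`-coercive ⟹ `‖blk (T⁻¹ − S⁻¹) x y‖ ≤ γ⁻²‖(T − S)_φ‖e^{−(φ(x)−φ(y))}`).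
* §2 THE WEIGHTED SIZE OF THE PERTURBATION (fine torus `Tor (fine L M)`, tree contour system of depth `≤ D`, unitary `U, V` with `‖U_b − V_b‖ ≤ ε` on every bond, weight `ctW L M κ_w x₀`, `κ_w ≥ 0`):
  `l2_opNorm_wtConj_le_of_blk_symm` (weighted block Schur test), `norm_blk_covLapF_sub_le` + ★★ `l2_opNorm_wtConj_covLapF_sub_le` (`‖(−cΔ_U + cΔ_V)_{ctW}‖ ≤ e^{κ_w∕L}·2(d+1)c·ε`, `c ≥ 0`),
  `blk_gram_covQ_site` (`blk (Q(U)ᴴQ(U)) x_j x′_{j′} = [same block]·L^{−2(d+1)}·U(Γ_j)ᴴU(Γ_{j′})`), `norm_blk_gram_sub_le`, ★★ `l2_opNorm_wtConj_gram_sub_le` (`‖(L^{d+1}(Q(U)ᴴQ(U) − Q(V)ᴴQ(V)))_{ctW}‖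
  ≤ e^{κ_w}·2D·ε`), ★★★ **`l2_opNorm_wtConj_fullOpU_sub_le`** (`‖(A₀(U) − A₀(V))_{ctW}‖ ≤ (e^{κ_w∕L}·2(d+1)c + e^{κ_w}·2aD)·ε`, `a ≥ 0`).
* §3 ★★★ **`norm_blk_fullOpU_inv_sub_le`** — both `A₀(U)`, `A₀(V)` `κ`-coercive, general `c`, rate `κ_w` with defect `ρ < κ`:
  `‖blk (G(U) − G(V)) x y‖ ≤ (κ − ρ)⁻²·(e^{κ_w∕L}2(d+1)c + e^{κ_w}2aD)·ε·e^{−(κ_w∕L)d(x,y)}`; ★★★ **`norm_blk_fullOpU_inv_sub_le_king`** (King's scaling, rate `ctRate`: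
  `≤ (2∕κ)²·e·(2(d+1)L² + 2aD)·ε·e^{−ctRate·d(x,y)∕L}` — the difference kernel DECAYS at the Combes–Thomas rate; Lipschitz constant `O(L²)` in the sup distance of the fields, honestly).
PRIOR TREE ART (by name): Ϧ-a (`wtConj`, `wtConj_mul∕sub∕inv`, `norm_blk_wtConj`, `norm_blk_le_opNorm`, `l2_opNorm_wtConj_inv_le`, `isUnit_of_conjCoercive`), Ϧ-b (`re_conjForm_fullOpU_ctW_ge`), Ϧ-c (`ctRate`,
`half_le_sub_rho_ctRate`), Ͱ-n (`blk_hop_sub_hop`, `blk_sub'`, `kingHopping`, `covLapF_eq`), Ϛ-l (`l2_opNorm_le_of_blk_symm`), Ͱ-q (`l2_opNorm_of_mem_unitaryGroup_le`), Ϥ-b∕Ϥ-c∕Ϥ-h (`treeHol`,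
`treeHol_mem_unitaryGroup`, `covQ_apply_site`, `norm_treeHol_sub_le`), `King1986.Torus` (`ctW`, `abs_ctW_bond_le`, `abs_ctW_block_le`, `blockEquiv`, `blockOf_site`), Mathlib (`Matrix.l2_opNorm_conjTranspose`,
`norm_mul_le`).  Dedup (rg at filing): basename 0 files; needles `wtConj_inv_sub_inv|norm_blk_inv_sub_inv_le_of_conjCoercive|blk_gram_covQ_site|l2_opNorm_wtConj_fullOpU_sub_le|norm_blk_fullOpU_inv_sub_le` 0 tree files.
Locators: [Balaban1985BackgroundPropagators] (3.23)–(3.27) p.394–395, (3.48)–(3.50) pp.398–400 (shape of «small changes of U change G(U) little, locally» — NOT reproduced at Bałaban's scale, see above);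
[King1986] (4.4)–(4.5) p.670; [DodziukMathai2006] §1 (resolvent comparison, notion).  0 `sorry`, 0 `def`.
-/

noncomputable section
open scoped BigOperators ComplexConjugate ComplexOrder InnerProductSpace Matrix.Norms.L2Operator
open Finset Matrix WithLp

namespace Summit.QuantumFields.YangMills.BalabanUVNodes.N15KingModelRung.CombesThomas

open Literature.MathematicalPhysics.QuantumFieldTheory.LatticeDiamagneticInequality (blk)
open Literature.MathematicalPhysics.QuantumFieldTheory.Balaban1983to89.B5Prop11Plancherel (Tor fine unitVec)
open Literature.MathematicalPhysics.QuantumFieldTheory.King1986.Torus (site blockOf blockOf_site blockEquiv blockEquiv_apply ctW abs_ctW_bond_le abs_ctW_block_le tdistT)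
open Summit.QuantumFields.YangMills.BalabanUVNodes.N15KingModelRung.Covariant
  (covLapF covLapF_eq kingHopping fib blk_hop_sub_hop blk_sub' l2_opNorm_le_of_blk_symm l2_opNorm_of_mem_unitaryGroup_le)
open Summit.QuantumFields.YangMills.BalabanUVNodes.N15KingModelRung.CovariantBlock
  (BlockTree covQ covQ_apply_site fullOpU treeHol treeHol_mem_unitaryGroup norm_treeHol_sub_le)

variable {d : ℕ}
variable {𝕜 : Type*} [RCLike 𝕜] {n : Type*} [Fintype n] [DecidableEq n]

/-! ## §1 The second resolvent identity in the weighted algebra -/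

section Resolvent

variable (K : Fin (d + 1) → ℕ) [hK : ∀ μ, NeZero (K μ)]

/-- THE SECOND RESOLVENT IDENTITY for invertible matrices: `T⁻¹ − S⁻¹ = T⁻¹(S − T)S⁻¹`. [folklore] -/
theorem inv_sub_inv_eq {T S : Matrix (Tor K × n) (Tor K × n) 𝕜} (hT : IsUnit T) (hS : IsUnit S) : T⁻¹ - S⁻¹ = T⁻¹ * (S - T) * S⁻¹ := by
  have hTd : IsUnit T.det := (Matrix.isUnit_iff_isUnit_det _).mp hT
  have hSd : IsUnit S.det := (Matrix.isUnit_iff_isUnit_det _).mp hS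
  rw [Matrix.mul_sub, Matrix.sub_mul, Matrix.mul_assoc, Matrix.mul_nonsing_inv _ hSd, Matrix.mul_one, Matrix.nonsing_inv_mul _ hTd, Matrix.one_mul]

/-- ★ THE RESOLVENT IDENTITY COMMUTES WITH THE CONJUGATION: `(T⁻¹ − S⁻¹)_φ = (T⁻¹)_φ·(S − T)_φ·(S⁻¹)_φ`. [folklore] -/
theorem wtConj_inv_sub_inv (φ : Tor K → ℝ) {T S : Matrix (Tor K × n) (Tor K × n) 𝕜} (hT : IsUnit T) (hS : IsUnit S) :
    wtConj K φ (T⁻¹ - S⁻¹) = wtConj K φ T⁻¹ * wtConj K φ (S - T) * wtConj K φ S⁻¹ := by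
  rw [inv_sub_inv_eq K hT hS, wtConj_mul, wtConj_mul]

/-- ★★ `‖(T⁻¹ − S⁻¹)_φ‖ ≤ ‖(T⁻¹)_φ‖·‖(S − T)_φ‖·‖(S⁻¹)_φ‖`. [folklore] -/
theorem norm_wtConj_inv_sub_inv_le (φ : Tor K → ℝ) {T S : Matrix (Tor K × n) (Tor K × n) 𝕜} (hT : IsUnit T) (hS : IsUnit S) :
    ‖wtConj K φ (T⁻¹ - S⁻¹)‖ ≤ ‖wtConj K φ T⁻¹‖ * ‖wtConj K φ (S - T)‖ * ‖wtConj K φ S⁻¹‖ := by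
  rw [wtConj_inv_sub_inv K φ hT hS]
  exact (norm_mul_le _ _).trans (mul_le_mul_of_nonneg_right (norm_mul_le _ _) (norm_nonneg _))

/-- ★★★ **TWO CONJUGATE-COERCIVE OPERATORS HAVE CLOSE, DECAYING INVERSES**: if `T_φ` and `S_φ` are both `γ`-coercive (`γ > 0`) then for all sites
`‖blk (T⁻¹ − S⁻¹) x y‖ ≤ γ⁻²·‖(T − S)_φ‖·e^{−(φ(x)−φ(y))}`. [cite: Balaban1985BackgroundPropagators, (3.48) p.398 (shape); DodziukMathai2006, §1] -/
theorem norm_blk_inv_sub_inv_le_of_conjCoercive {φ : Tor K → ℝ} {T S : Matrix (Tor K × n) (Tor K × n) 𝕜} {γ : ℝ} (hγ : 0 < γ)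
    (hT : ∀ ω : Tor K × n → 𝕜, γ * ∑ x, ‖fib K ω x‖ ^ 2 ≤ RCLike.re (star ω ⬝ᵥ (wtConj K φ T *ᵥ ω)))
    (hS : ∀ ω : Tor K × n → 𝕜, γ * ∑ x, ‖fib K ω x‖ ^ 2 ≤ RCLike.re (star ω ⬝ᵥ (wtConj K φ S *ᵥ ω))) (x y : Tor K) :
    ‖blk (T⁻¹ - S⁻¹) x y‖ ≤ (γ⁻¹) ^ 2 * ‖wtConj K φ (T - S)‖ * Real.exp (-(φ x - φ y)) := by
  have hTu : IsUnit T := isUnit_of_conjCoercive K hγ hT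
  have hSu : IsUnit S := isUnit_of_conjCoercive K hγ hS
  have h1 : ‖blk (wtConj K φ (T⁻¹ - S⁻¹)) x y‖ ≤ (γ⁻¹) ^ 2 * ‖wtConj K φ (T - S)‖ := by
    refine (norm_blk_le_opNorm K _ x y).trans ((norm_wtConj_inv_sub_inv_le K φ hTu hSu).trans ?_)
    have hneg : wtConj K φ (S - T) = -wtConj K φ (T - S) := by
      ext p q; simp only [wtConj_apply, Matrix.sub_apply, Matrix.neg_apply]; ring
    have hST : ‖wtConj K φ (S - T)‖ = ‖wtConj K φ (T - S)‖ := by rw [hneg, norm_neg]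
    rw [hST]
    have hA := l2_opNorm_wtConj_inv_le K hγ hT
    have hC := l2_opNorm_wtConj_inv_le K hγ hS
    calc ‖wtConj K φ T⁻¹‖ * ‖wtConj K φ (T - S)‖ * ‖wtConj K φ S⁻¹‖ ≤ γ⁻¹ * ‖wtConj K φ (T - S)‖ * γ⁻¹ :=
          mul_le_mul (mul_le_mul_of_nonneg_right hA (norm_nonneg _)) hC (norm_nonneg _) (by positivity)
      _ = (γ⁻¹) ^ 2 * ‖wtConj K φ (T - S)‖ := by ring
  rw [norm_blk_wtConj] at h1
  calc ‖blk (T⁻¹ - S⁻¹) x y‖ = Real.exp (-(φ x - φ y)) * (Real.exp (φ x - φ y) * ‖blk (T⁻¹ - S⁻¹) x y‖) := by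
        rw [← mul_assoc, ← Real.exp_add, neg_add_cancel, Real.exp_zero, one_mul]
    _ ≤ Real.exp (-(φ x - φ y)) * ((γ⁻¹) ^ 2 * ‖wtConj K φ (T - S)‖) := mul_le_mul_of_nonneg_left h1 (Real.exp_nonneg _)
    _ = (γ⁻¹) ^ 2 * ‖wtConj K φ (T - S)‖ * Real.exp (-(φ x - φ y)) := by ring

/-- THE WEIGHTED BLOCK SCHUR TEST: `‖blk X x y‖ ≤ b(x,y)`, and the weighted majorant `e^{|φ(x)−φ(y)|}b(x,y)` has row and column sums `≤ R` ⟹ `‖X_φ‖ ≤ R` (Ϛ-l `l2_opNorm_le_of_blk_symm`). [folklore] -/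
theorem l2_opNorm_wtConj_le_of_blk_symm (φ : Tor K → ℝ) {X : Matrix (Tor K × n) (Tor K × n) 𝕜} {b : Tor K → Tor K → ℝ} (hb : ∀ x y, ‖blk X x y‖ ≤ b x y) {R : ℝ}
    (hR : ∀ x, ∑ y, Real.exp |φ x - φ y| * b x y ≤ R) (hC : ∀ y, ∑ x, Real.exp |φ x - φ y| * b x y ≤ R) : ‖wtConj K φ X‖ ≤ R := by
  refine l2_opNorm_le_of_blk_symm K (a := fun x y => Real.exp |φ x - φ y| * b x y) (fun x y => ?_) hR hC
  rw [norm_blk_wtConj]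
  exact mul_le_mul (Real.exp_le_exp.mpr (le_abs_self _)) (hb x y) (norm_nonneg _) (Real.exp_nonneg _)

end Resolvent

/-! ## §2 The weighted size of `A₀(U) − A₀(V)` -/

section Perturbation

variable {L : ℕ} [NeZero L] (T : BlockTree d L) (M : Fin (d + 1) → ℕ) [hM : ∀ μ, NeZero (M μ)]

/-- THE BLOCKS OF `(−cΔ_U+m²) − (−cΔ_V+m²)` are bounded by `|c|·ε` on nearest-neighbour pairs (`‖U_b − V_b‖ ≤ ε` on every bond) and vanish elsewhere:
`‖blk (M_U − M_V) z w‖ ≤ |c|·ε·Σ_μ([w = z+e_μ] + [w = z−e_μ])`. [cite: Balaban1985BackgroundPropagators, (3.23) p.394; King1986, (4.4) p.670] -/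
theorem norm_blk_covLapF_sub_le {K : Fin (d + 1) → ℕ} [∀ μ, NeZero (K μ)] (c m2 : ℝ) {U V : Tor K × Fin (d + 1) → Matrix n n 𝕜} {ε : ℝ} (hε : ∀ b, ‖U b - V b‖ ≤ ε) (z w : Tor K) :
    ‖blk (covLapF K c m2 U - covLapF K c m2 V) z w‖ ≤ |c| * ε * ∑ μ : Fin (d + 1), ((if w = z + unitVec K μ then (1 : ℝ) else 0) + (if w = z - unitVec K μ then (1 : ℝ) else 0)) := by
  have hdiff : covLapF K c m2 U - covLapF K c m2 V = (kingHopping K c m2).hop V - (kingHopping K c m2).hop U := by rw [covLapF_eq, covLapF_eq]; abel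
  rw [hdiff, blk_hop_sub_hop, norm_smul, RCLike.norm_ofReal, mul_assoc]
  refine mul_le_mul_of_nonneg_left ((norm_sum_le _ _).trans ?_) (abs_nonneg c)
  rw [Finset.mul_sum]
  refine Finset.sum_le_sum fun μ _ => (norm_add_le _ _).trans ?_
  rw [mul_add]
  refine add_le_add ?_ ?_
  · by_cases h : w = z + unitVec K μ
    · rw [if_pos h, if_pos h, mul_one, norm_sub_rev]; exact hε _
    · rw [if_neg h, if_neg h, norm_zero, mul_zero]
  · by_cases h : w = z - unitVec K μ
    · rw [if_pos h, if_pos h, mul_one, Matrix.l2_opNorm_conjTranspose, norm_sub_rev]; exact hε _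
    · rw [if_neg h, if_neg h, norm_zero, mul_zero]

/-- ★★ **THE WEIGHTED FINE-LAPLACIAN PERTURBATION**: `‖((−cΔ_U+m²) − (−cΔ_V+m²))_{ctW}‖ ≤ e^{κ_w∕L}·2(d+1)|c|·ε` for the weight `ctW L M κ_w x₀` (`κ_w ≥ 0`; bond oscillation `κ_w∕L`).
[cite: Balaban1985BackgroundPropagators, (3.23) p.394, (3.48) p.398 (shape); King1986, (4.4) p.670] -/
theorem l2_opNorm_wtConj_covLapF_sub_le (c m2 : ℝ) {U V : Tor (fine L M) × Fin (d + 1) → Matrix n n 𝕜} {ε : ℝ} (hε0 : 0 ≤ ε) (hε : ∀ b, ‖U b - V b‖ ≤ ε)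
    {κw : ℝ} (hκw : 0 ≤ κw) (x₀ : Tor (fine L M)) :
    ‖wtConj (fine L M) (ctW L M κw x₀) (covLapF (fine L M) c m2 U - covLapF (fine L M) c m2 V)‖ ≤ Real.exp (κw / L) * (2 * ((d : ℝ) + 1) * |c| * ε) := by
  set φ := ctW L M κw x₀ with hφ
  set b : Tor (fine L M) → Tor (fine L M) → ℝ := fun z w =>
    |c| * ε * ∑ μ : Fin (d + 1), ((if w = z + unitVec (fine L M) μ then (1 : ℝ) else 0) + (if w = z - unitVec (fine L M) μ then (1 : ℝ) else 0)) with hb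
  -- the weight across a bond
  have hwt : ∀ z w, Real.exp |φ z - φ w| * b z w ≤ Real.exp (κw / L) * b z w := by
    intro z w
    by_cases hnb : ∃ μ, w = z + unitVec (fine L M) μ ∨ w = z - unitVec (fine L M) μ
    · obtain ⟨μ, hμ⟩ := hnb
      refine mul_le_mul_of_nonneg_right (Real.exp_le_exp.mpr ?_) (by simp only [hb]; positivity)
      rcases hμ with h | h
      · rw [h]; exact (abs_ctW_bond_le L M hκw x₀ z μ).1
      · rw [h]; exact (abs_ctW_bond_le L M hκw x₀ z μ).2
    · have hzw : b z w = 0 := by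
        simp only [hb]
        refine mul_eq_zero_of_right _ (Finset.sum_eq_zero fun μ _ => ?_)
        rw [if_neg (fun h => hnb ⟨μ, Or.inl h⟩), if_neg (fun h => hnb ⟨μ, Or.inr h⟩), add_zero]
      rw [hzw, mul_zero, mul_zero]
  -- row and column sums of `b`
  have hrow : ∀ z, ∑ w, b z w = 2 * ((d : ℝ) + 1) * |c| * ε := by
    intro z
    simp only [hb, ← Finset.mul_sum]
    rw [Finset.sum_comm]
    simp only [Finset.sum_add_distrib, Finset.sum_ite_eq' Finset.univ, Finset.mem_univ, if_true, Finset.sum_const, Finset.card_univ, Fintype.card_fin, nsmul_eq_mul]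
    push_cast; ring
  have hcol : ∀ w, ∑ z, b z w = 2 * ((d : ℝ) + 1) * |c| * ε := by
    intro w
    simp only [hb, ← Finset.mul_sum]
    rw [Finset.sum_comm]
    have h1 : ∀ μ : Fin (d + 1), ∑ z : Tor (fine L M), ((if w = z + unitVec (fine L M) μ then (1 : ℝ) else 0) + (if w = z - unitVec (fine L M) μ then (1 : ℝ) else 0)) = 2 := by
      intro μ
      rw [Finset.sum_add_distrib]
      have ha : ∑ z : Tor (fine L M), (if w = z + unitVec (fine L M) μ then (1 : ℝ) else 0) = 1 := by
        rw [Finset.sum_eq_single (w - unitVec (fine L M) μ)]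
        · rw [if_pos (by rw [sub_add_cancel])]
        · intro z _ hz; rw [if_neg]; intro h; exact hz (by rw [h, add_sub_cancel_right])
        · intro h; exact absurd (Finset.mem_univ _) h
      have hb' : ∑ z : Tor (fine L M), (if w = z - unitVec (fine L M) μ then (1 : ℝ) else 0) = 1 := by
        rw [Finset.sum_eq_single (w + unitVec (fine L M) μ)]
        · rw [if_pos (by rw [add_sub_cancel_right])]
        · intro z _ hz; rw [if_neg]; intro h; exact hz (by rw [h, sub_add_cancel])
        · intro h; exact absurd (Finset.mem_univ _) h
      rw [ha, hb']; norm_num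
    simp only [h1, Finset.sum_const, Finset.card_univ, Fintype.card_fin, nsmul_eq_mul]
    push_cast; ring
  refine l2_opNorm_wtConj_le_of_blk_symm (fine L M) φ (fun z w => norm_blk_covLapF_sub_le c m2 hε z w) (R := Real.exp (κw / L) * (2 * ((d : ℝ) + 1) * |c| * ε)) ?_ ?_
  · intro z
    calc ∑ w, Real.exp |φ z - φ w| * b z w ≤ ∑ w, Real.exp (κw / L) * b z w := Finset.sum_le_sum fun w _ => hwt z w
      _ = Real.exp (κw / L) * (2 * ((d : ℝ) + 1) * |c| * ε) := by rw [← Finset.mul_sum, hrow]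
  · intro w
    calc ∑ z, Real.exp |φ z - φ w| * b z w ≤ ∑ z, Real.exp (κw / L) * b z w := Finset.sum_le_sum fun z _ => hwt z w
      _ = Real.exp (κw / L) * (2 * ((d : ℝ) + 1) * |c| * ε) := by rw [← Finset.mul_sum, hcol]

/-- THE BLOCKS OF THE GRAM OPERATOR `Q(U)ᴴQ(U)`: `blk (Q(U)ᴴQ(U)) (site β j) (site β′ j′) = [β = β′]·L^{−2(d+1)}·U(Γ_j)ᴴU(Γ_{j′})` (PART Ϥ-c `covQ_apply_site`).
[cite: Balaban1985BackgroundPropagators, (3.19) p.393, (3.24) p.394; King1986, (2.13) p.653] -/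
theorem blk_gram_covQ_site (U : Tor (fine L M) × Fin (d + 1) → Matrix n n 𝕜) (β β' : Tor M) (j j' : Fin (d + 1) → Fin L) :
    blk ((covQ T M U)ᴴ * covQ T M U) (site L M β j) (site L M β' j')
      = if β = β' then ((((L : ℝ) ^ (d + 1))⁻¹ ^ 2 : ℝ) : 𝕜) • ((treeHol M T U β j)ᴴ * treeHol M T U β' j') else 0 := by
  have hc : ((L : 𝕜) ^ (d + 1))⁻¹ = (((((L : ℝ) ^ (d + 1))⁻¹ : ℝ)) : 𝕜) := by push_cast; ring
  ext k k'
  simp only [blk, Matrix.of_apply, Matrix.mul_apply, Matrix.conjTranspose_apply, Fintype.sum_prod_type, covQ_apply_site]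
  by_cases h : β = β'
  · subst h
    rw [if_pos rfl, Finset.sum_eq_single β]
    · simp only [if_true, Matrix.smul_apply, Matrix.mul_apply, Matrix.conjTranspose_apply, smul_eq_mul, Finset.mul_sum, hc, star_mul', RCLike.star_def, RCLike.conj_ofReal]
      refine Finset.sum_congr rfl fun i _ => ?_
      push_cast; ring
    · intro b _ hb; exact Finset.sum_eq_zero fun i _ => by rw [if_neg (Ne.symm hb).symm, star_zero, zero_mul]
    · intro hβ; exact absurd (Finset.mem_univ β) hβ
  · rw [if_neg h]
    refine Finset.sum_eq_zero fun b _ => Finset.sum_eq_zero fun i _ => ?_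
    by_cases hb : b = β
    · subst hb; rw [if_neg h, mul_zero]
    · rw [if_neg hb, star_zero, zero_mul]

/-- `‖blk (L^{d+1}(Q(U)ᴴQ(U) − Q(V)ᴴQ(V))) x x′‖ ≤ [same block]·L^{−(d+1)}·2Dε` for unitary `U, V` with `‖U_b − V_b‖ ≤ ε` on bonds and contours of depth `≤ D` (`‖U(Γ) − V(Γ)‖ ≤ Dε`, PART Ϥ-h).
[cite: Balaban1985BackgroundPropagators, (3.19) p.393, (3.24) p.394] -/
theorem norm_blk_gram_sub_le {D : ℕ} (hD : ∀ j, T.depth j ≤ D) {U V : Tor (fine L M) × Fin (d + 1) → Matrix n n 𝕜} (hU : ∀ bd, U bd ∈ Matrix.unitaryGroup n 𝕜)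
    (hV : ∀ bd, V bd ∈ Matrix.unitaryGroup n 𝕜) {ε : ℝ} (hε0 : 0 ≤ ε) (hε : ∀ bd, ‖U bd - V bd‖ ≤ ε) (x x' : Tor (fine L M)) :
    ‖blk ((((L : ℝ) ^ (d + 1) : ℝ) : 𝕜) • ((covQ T M U)ᴴ * covQ T M U - ((covQ T M V)ᴴ * covQ T M V))) x x'‖
      ≤ if blockOf L M x = blockOf L M x' then ((L : ℝ) ^ (d + 1))⁻¹ * (2 * D * ε) else 0 := by
  have hL0 : (0 : ℝ) < (L : ℝ) ^ (d + 1) := by have : (0 : ℝ) < L := (by exact_mod_cast Nat.pos_of_ne_zero (NeZero.ne L)); positivity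
  obtain ⟨⟨β, j⟩, rfl⟩ := (blockEquiv L M).surjective x
  obtain ⟨⟨β', j'⟩, rfl⟩ := (blockEquiv L M).surjective x'
  simp only [blockEquiv_apply, blockOf_site]
  have hblk : blk ((((L : ℝ) ^ (d + 1) : ℝ) : 𝕜) • ((covQ T M U)ᴴ * covQ T M U - ((covQ T M V)ᴴ * covQ T M V))) (site L M β j) (site L M β' j')
      = (((L : ℝ) ^ (d + 1) : ℝ) : 𝕜) • (blk ((covQ T M U)ᴴ * covQ T M U) (site L M β j) (site L M β' j') - blk ((covQ T M V)ᴴ * covQ T M V) (site L M β j) (site L M β' j')) := by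
    ext k k'; simp only [blk, Matrix.of_apply, Matrix.smul_apply, Matrix.sub_apply, smul_eq_mul]
  rw [hblk, blk_gram_covQ_site, blk_gram_covQ_site]
  by_cases h : β = β'
  · subst h
    rw [if_pos rfl, if_pos rfl, if_pos rfl, ← smul_sub, smul_smul, norm_smul]
    have hsc : ‖(((L : ℝ) ^ (d + 1) : ℝ) : 𝕜) * ((((L : ℝ) ^ (d + 1))⁻¹ ^ 2 : ℝ) : 𝕜)‖ = ((L : ℝ) ^ (d + 1))⁻¹ := by
      rw [← RCLike.ofReal_mul, RCLike.norm_ofReal, abs_of_nonneg (by positivity)]; field_simp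
    rw [hsc]
    refine mul_le_mul_of_nonneg_left ?_ (by positivity)
    -- `‖AᴴB − CᴴD‖ ≤ ‖A − C‖ + ‖B − D‖` for contractions
    have hA := norm_treeHol_sub_le T M hU hV hε β j
    have hB := norm_treeHol_sub_le T M hU hV hε β j'
    have h1 : (treeHol M T U β j)ᴴ * treeHol M T U β j' - (treeHol M T V β j)ᴴ * treeHol M T V β j'
        = (treeHol M T U β j - treeHol M T V β j)ᴴ * treeHol M T U β j' + (treeHol M T V β j)ᴴ * (treeHol M T U β j' - treeHol M T V β j') := by
      rw [Matrix.conjTranspose_sub, Matrix.sub_mul, Matrix.mul_sub]; abel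
    rw [h1]
    calc ‖(treeHol M T U β j - treeHol M T V β j)ᴴ * treeHol M T U β j' + (treeHol M T V β j)ᴴ * (treeHol M T U β j' - treeHol M T V β j')‖
        ≤ ‖(treeHol M T U β j - treeHol M T V β j)ᴴ‖ * ‖treeHol M T U β j'‖ + ‖(treeHol M T V β j)ᴴ‖ * ‖treeHol M T U β j' - treeHol M T V β j'‖ :=
          (norm_add_le _ _).trans (add_le_add (norm_mul_le _ _) (norm_mul_le _ _))
      _ ≤ (D * ε) * 1 + 1 * (D * ε) := by
          rw [Matrix.l2_opNorm_conjTranspose, Matrix.l2_opNorm_conjTranspose]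
          gcongr
          · exact hA.trans (mul_le_mul_of_nonneg_right (by exact_mod_cast hD j) hε0)
          · exact l2_opNorm_of_mem_unitaryGroup_le (treeHol_mem_unitaryGroup T M hU β j')
          · exact l2_opNorm_of_mem_unitaryGroup_le (treeHol_mem_unitaryGroup T M hV β j)
          · exact hB.trans (mul_le_mul_of_nonneg_right (by exact_mod_cast hD j') hε0)
      _ = 2 * D * ε := by ring
  · rw [if_neg h, if_neg h, if_neg h, sub_zero, smul_zero, norm_zero]

/-- ★★ **THE WEIGHTED BLOCK-TERM PERTURBATION**: `‖(L^{d+1}(Q(U)ᴴQ(U) − Q(V)ᴴQ(V)))_{ctW}‖ ≤ e^{κ_w}·2D·ε` (block oscillation `κ_w` of the weight; `L^{d+1}` sites per block).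
[cite: Balaban1985BackgroundPropagators, (3.19) p.393, (3.24) p.394, (3.48) p.398 (shape)] -/
theorem l2_opNorm_wtConj_gram_sub_le {D : ℕ} (hD : ∀ j, T.depth j ≤ D) {U V : Tor (fine L M) × Fin (d + 1) → Matrix n n 𝕜} (hU : ∀ bd, U bd ∈ Matrix.unitaryGroup n 𝕜)
    (hV : ∀ bd, V bd ∈ Matrix.unitaryGroup n 𝕜) {ε : ℝ} (hε0 : 0 ≤ ε) (hε : ∀ bd, ‖U bd - V bd‖ ≤ ε) {κw : ℝ} (hκw : 0 ≤ κw) (x₀ : Tor (fine L M)) :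
    ‖wtConj (fine L M) (ctW L M κw x₀) ((((L : ℝ) ^ (d + 1) : ℝ) : 𝕜) • ((covQ T M U)ᴴ * covQ T M U - ((covQ T M V)ᴴ * covQ T M V)))‖ ≤ Real.exp κw * (2 * D * ε) := by
  have hL0 : (0 : ℝ) < (L : ℝ) ^ (d + 1) := by have : (0 : ℝ) < L := (by exact_mod_cast Nat.pos_of_ne_zero (NeZero.ne L)); positivity
  set φ := ctW L M κw x₀ with hφ
  set b : Tor (fine L M) → Tor (fine L M) → ℝ := fun x x' => if blockOf L M x = blockOf L M x' then ((L : ℝ) ^ (d + 1))⁻¹ * (2 * D * ε) else 0 with hb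
  have hbsymm : ∀ x x', b x' x = b x x' := fun x x' => by simp only [hb, eq_comm]
  have hwt : ∀ x x', Real.exp |φ x - φ x'| * b x x' ≤ Real.exp κw * b x x' := by
    intro x x'
    by_cases h : blockOf L M x = blockOf L M x'
    · exact mul_le_mul_of_nonneg_right (Real.exp_le_exp.mpr (abs_ctW_block_le L M hκw x₀ x x' h)) (by simp only [hb]; positivity)
    · simp only [hb, if_neg h, mul_zero, le_refl]
  have hrow : ∀ x, ∑ x', b x x' = 2 * D * ε := by
    intro x
    rw [← (blockEquiv L M).sum_comp, Fintype.sum_prod_type]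
    simp only [hb, blockEquiv_apply, blockOf_site]
    rw [Finset.sum_eq_single (blockOf L M x)]
    · simp only [if_true, Finset.sum_const, Finset.card_univ, Fintype.card_fun, Fintype.card_fin, nsmul_eq_mul]
      push_cast; field_simp
    · intro b' _ hb'; exact Finset.sum_eq_zero fun j _ => by rw [if_neg (Ne.symm hb')]
    · intro h; exact absurd (Finset.mem_univ _) h
  refine l2_opNorm_wtConj_le_of_blk_symm (fine L M) φ (fun x x' => norm_blk_gram_sub_le T M hD hU hV hε0 hε x x') (R := Real.exp κw * (2 * D * ε)) ?_ ?_
  · intro x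
    calc ∑ x', Real.exp |φ x - φ x'| * b x x' ≤ ∑ x', Real.exp κw * b x x' := Finset.sum_le_sum fun x' _ => hwt x x'
      _ = Real.exp κw * (2 * D * ε) := by rw [← Finset.mul_sum, hrow]
  · intro x'
    calc ∑ x, Real.exp |φ x - φ x'| * b x x' ≤ ∑ x, Real.exp κw * b x x' := Finset.sum_le_sum fun x _ => hwt x x'
      _ = Real.exp κw * (2 * D * ε) := by
          rw [← Finset.mul_sum]; congr 1
          rw [show ∑ x, b x x' = ∑ x, b x' x from Finset.sum_congr rfl fun x _ => hbsymm x' x ▸ rfl, hrow]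

/-- ★★★ **THE WEIGHTED SIZE OF THE PERTURBATION OF THE FULL OPERATOR**: for unitary `U, V` with `‖U_b − V_b‖ ≤ ε` on every bond, contours of depth `≤ D`, `a, c ≥ 0`, `κ_w ≥ 0`:
`‖(A₀(U) − A₀(V))_{ctW}‖ ≤ (e^{κ_w∕L}·2(d+1)c + e^{κ_w}·2aD)·ε`. [cite: Balaban1985BackgroundPropagators, (3.24) p.394, (3.48) p.398 (shape); King1986, (4.5) p.670] -/
theorem l2_opNorm_wtConj_fullOpU_sub_le {D : ℕ} (hD : ∀ j, T.depth j ≤ D) {a c : ℝ} (ha : 0 ≤ a) (hc : 0 ≤ c) (m2 : ℝ) {U V : Tor (fine L M) × Fin (d + 1) → Matrix n n 𝕜}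
    (hU : ∀ bd, U bd ∈ Matrix.unitaryGroup n 𝕜) (hV : ∀ bd, V bd ∈ Matrix.unitaryGroup n 𝕜) {ε : ℝ} (hε0 : 0 ≤ ε) (hε : ∀ bd, ‖U bd - V bd‖ ≤ ε) {κw : ℝ} (hκw : 0 ≤ κw)
    (x₀ : Tor (fine L M)) :
    ‖wtConj (fine L M) (ctW L M κw x₀) (fullOpU T M a c m2 U - fullOpU T M a c m2 V)‖
      ≤ (Real.exp (κw / L) * (2 * ((d : ℝ) + 1) * c) + Real.exp κw * (2 * a * D)) * ε := by
  have hsplit : fullOpU T M a c m2 U - fullOpU T M a c m2 V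
      = (covLapF (fine L M) c m2 U - covLapF (fine L M) c m2 V) + (a : 𝕜) • ((((L : ℝ) ^ (d + 1) : ℝ) : 𝕜) • ((covQ T M U)ᴴ * covQ T M U - ((covQ T M V)ᴴ * covQ T M V))) := by
    rw [fullOpU, fullOpU, smul_smul, ← RCLike.ofReal_mul, smul_sub]; abel
  rw [hsplit, wtConj_add, wtConj_smul]
  refine (norm_add_le _ _).trans ?_
  rw [norm_smul, RCLike.norm_ofReal, abs_of_nonneg ha]
  have h1 := l2_opNorm_wtConj_covLapF_sub_le M c m2 hε0 hε hκw x₀ (U := U) (V := V)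
  have h2 := l2_opNorm_wtConj_gram_sub_le T M hD hU hV hε0 hε hκw x₀
  rw [abs_of_nonneg hc] at h1
  calc ‖wtConj (fine L M) (ctW L M κw x₀) (covLapF (fine L M) c m2 U - covLapF (fine L M) c m2 V)‖
        + a * ‖wtConj (fine L M) (ctW L M κw x₀) ((((L : ℝ) ^ (d + 1) : ℝ) : 𝕜) • ((covQ T M U)ᴴ * covQ T M U - ((covQ T M V)ᴴ * covQ T M V)))‖
      ≤ Real.exp (κw / L) * (2 * ((d : ℝ) + 1) * c * ε) + a * (Real.exp κw * (2 * D * ε)) := add_le_add h1 (mul_le_mul_of_nonneg_left h2 ha)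
    _ = (Real.exp (κw / L) * (2 * ((d : ℝ) + 1) * c) + Real.exp κw * (2 * a * D)) * ε := by ring

end Perturbation

/-! ## §3 The Lipschitz–locality theorem -/

section Lipschitz

variable {L : ℕ} [NeZero L] (T : BlockTree d L) (M : Fin (d + 1) → ℕ) [hM : ∀ μ, NeZero (M μ)]

/-- ★★★ **THE RESPONSE OF THE BACKGROUND PROPAGATOR IS LOCAL**: two unitary fields with `‖U_b − V_b‖ ≤ ε` on every bond, both `A₀(U)`, `A₀(V)` `κ`-coercive, `a, c ≥ 0`, contours of depth `≤ D`,
a rate `κ_w ≥ 0` with defect `ρ = 2(d+1)c(cosh(κ_w∕L)−1) + a(cosh κ_w−1) < κ`: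
`‖blk (G(U) − G(V)) x y‖ ≤ (κ − ρ)⁻²·(e^{κ_w∕L}2(d+1)c + e^{κ_w}2aD)·ε·e^{−(κ_w∕L)d(x,y)}`. [cite: Balaban1985BackgroundPropagators, (3.48) p.398 (shape); King1986, (4.5) p.670] -/
theorem norm_blk_fullOpU_inv_sub_le {D : ℕ} (hD : ∀ j, T.depth j ≤ D) {a c : ℝ} (ha : 0 ≤ a) (hc : 0 ≤ c) (m2 : ℝ) {U V : Tor (fine L M) × Fin (d + 1) → Matrix n n 𝕜}
    (hU : ∀ bd, U bd ∈ Matrix.unitaryGroup n 𝕜) (hV : ∀ bd, V bd ∈ Matrix.unitaryGroup n 𝕜) {ε : ℝ} (hε0 : 0 ≤ ε) (hε : ∀ bd, ‖U bd - V bd‖ ≤ ε) {κ : ℝ}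
    (hcoU : ∀ v : Tor (fine L M) × n → 𝕜, κ * ∑ x, ‖fib (fine L M) v x‖ ^ 2 ≤ RCLike.re (star v ⬝ᵥ (fullOpU T M a c m2 U *ᵥ v)))
    (hcoV : ∀ v : Tor (fine L M) × n → 𝕜, κ * ∑ x, ‖fib (fine L M) v x‖ ^ 2 ≤ RCLike.re (star v ⬝ᵥ (fullOpU T M a c m2 V *ᵥ v)))
    {κw : ℝ} (hκw : 0 ≤ κw) (hρ : 2 * ((d : ℝ) + 1) * c * (Real.cosh (κw / L) - 1) + a * (Real.cosh κw - 1) < κ) (x y : Tor (fine L M)) :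
    ‖blk ((fullOpU T M a c m2 U)⁻¹ - (fullOpU T M a c m2 V)⁻¹) x y‖
      ≤ ((κ - 2 * ((d : ℝ) + 1) * c * (Real.cosh (κw / L) - 1) - a * (Real.cosh κw - 1))⁻¹) ^ 2
        * ((Real.exp (κw / L) * (2 * ((d : ℝ) + 1) * c) + Real.exp κw * (2 * a * D)) * ε) * Real.exp (-(κw / L * tdistT (fine L M) x y)) := by
  have h := norm_blk_inv_sub_inv_le_of_conjCoercive (fine L M) (φ := ctW L M κw y) (by linarith)
    (re_conjForm_fullOpU_ctW_ge T M ha hc m2 hU hcoU hκw y) (re_conjForm_fullOpU_ctW_ge T M ha hc m2 hV hcoV hκw y) x y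
  rw [ctW_sub_ctW_centre] at h
  refine h.trans (mul_le_mul_of_nonneg_right (mul_le_mul_of_nonneg_left (l2_opNorm_wtConj_fullOpU_sub_le T M hD ha hc m2 hU hV hε0 hε hκw y) (sq_nonneg _)) (Real.exp_nonneg _))

/-- ★★★ **KING's SCALING** (`c = L²`, `L ≥ 1`, rate `ctRate(κ,a,d)`): `‖blk (G(U) − G(V)) x y‖ ≤ (2∕κ)²·e·(2(d+1)L² + 2aD)·ε·e^{−ctRate·d(x,y)∕L}` — the difference kernel decays at the Combes–Thomas
rate; the Lipschitz constant in the sup distance of the fields is `O(L²)` = `O(η⁻²)` (the `ℓ²` currency; see the header for what this does and does not say).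
[cite: Balaban1985BackgroundPropagators, (3.48) p.398 (shape); King1986, (4.5) p.670] -/
theorem norm_blk_fullOpU_inv_sub_le_king (hL : 1 ≤ L) {D : ℕ} (hD : ∀ j, T.depth j ≤ D) {a : ℝ} (ha : 0 ≤ a) (m2 : ℝ) {U V : Tor (fine L M) × Fin (d + 1) → Matrix n n 𝕜}
    (hU : ∀ bd, U bd ∈ Matrix.unitaryGroup n 𝕜) (hV : ∀ bd, V bd ∈ Matrix.unitaryGroup n 𝕜) {ε : ℝ} (hε0 : 0 ≤ ε) (hε : ∀ bd, ‖U bd - V bd‖ ≤ ε) {κ : ℝ} (hκ : 0 < κ)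
    (hcoU : ∀ v : Tor (fine L M) × n → 𝕜, κ * ∑ x, ‖fib (fine L M) v x‖ ^ 2 ≤ RCLike.re (star v ⬝ᵥ (fullOpU T M a ((L : ℝ) ^ 2) m2 U *ᵥ v)))
    (hcoV : ∀ v : Tor (fine L M) × n → 𝕜, κ * ∑ x, ‖fib (fine L M) v x‖ ^ 2 ≤ RCLike.re (star v ⬝ᵥ (fullOpU T M a ((L : ℝ) ^ 2) m2 V *ᵥ v))) (x y : Tor (fine L M)) :
    ‖blk ((fullOpU T M a ((L : ℝ) ^ 2) m2 U)⁻¹ - (fullOpU T M a ((L : ℝ) ^ 2) m2 V)⁻¹) x y‖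
      ≤ (2 / κ) ^ 2 * (Real.exp 1 * (2 * ((d : ℝ) + 1) * (L : ℝ) ^ 2 + 2 * a * D) * ε) * Real.exp (-(ctRate κ a d / L * tdistT (fine L M) x y)) := by
  have hL0 : (0 : ℝ) < L := by exact_mod_cast hL
  have hhalf := half_le_sub_rho_ctRate (d := d) hL hκ ha
  have hρ : 2 * ((d : ℝ) + 1) * (L : ℝ) ^ 2 * (Real.cosh (ctRate κ a d / L) - 1) + a * (Real.cosh (ctRate κ a d) - 1) < κ := by linarith
  have h := norm_blk_fullOpU_inv_sub_le T M hD ha (by positivity) m2 hU hV hε0 hε hcoU hcoV (ctRate_nonneg κ a d) hρ x y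
  refine h.trans (mul_le_mul_of_nonneg_right ?_ (Real.exp_nonneg _))
  have hinv : (κ - 2 * ((d : ℝ) + 1) * (L : ℝ) ^ 2 * (Real.cosh (ctRate κ a d / L) - 1) - a * (Real.cosh (ctRate κ a d) - 1))⁻¹ ≤ 2 / κ := by
    rw [show (2 : ℝ) / κ = (κ / 2)⁻¹ by rw [inv_div]]; exact inv_anti₀ (by positivity) hhalf
  have hinv0 : 0 ≤ (κ - 2 * ((d : ℝ) + 1) * (L : ℝ) ^ 2 * (Real.cosh (ctRate κ a d / L) - 1) - a * (Real.cosh (ctRate κ a d) - 1))⁻¹ := inv_nonneg.mpr (by linarith)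
  have he1 : Real.exp (ctRate κ a d / L) ≤ Real.exp 1 := Real.exp_le_exp.mpr ((div_le_one hL0).mpr ((ctRate_le_one κ a d).trans (by exact_mod_cast hL)))
  have he2 : Real.exp (ctRate κ a d) ≤ Real.exp 1 := Real.exp_le_exp.mpr (ctRate_le_one κ a d)
  have hpert : (Real.exp (ctRate κ a d / L) * (2 * ((d : ℝ) + 1) * (L : ℝ) ^ 2) + Real.exp (ctRate κ a d) * (2 * a * D)) * ε
      ≤ Real.exp 1 * (2 * ((d : ℝ) + 1) * (L : ℝ) ^ 2 + 2 * a * D) * ε := by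
    refine mul_le_mul_of_nonneg_right ?_ hε0
    nlinarith [mul_le_mul_of_nonneg_right he1 (by positivity : (0 : ℝ) ≤ 2 * ((d : ℝ) + 1) * (L : ℝ) ^ 2), mul_le_mul_of_nonneg_right he2 (by positivity : (0 : ℝ) ≤ 2 * a * D)]
  calc ((κ - 2 * ((d : ℝ) + 1) * (L : ℝ) ^ 2 * (Real.cosh (ctRate κ a d / L) - 1) - a * (Real.cosh (ctRate κ a d) - 1))⁻¹) ^ 2
        * ((Real.exp (ctRate κ a d / L) * (2 * ((d : ℝ) + 1) * (L : ℝ) ^ 2) + Real.exp (ctRate κ a d) * (2 * a * D)) * ε)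
      ≤ (2 / κ) ^ 2 * (Real.exp 1 * (2 * ((d : ℝ) + 1) * (L : ℝ) ^ 2 + 2 * a * D) * ε) :=
        mul_le_mul (pow_le_pow_left₀ hinv0 hinv 2) hpert (by positivity) (by positivity)

end Lipschitz

end Summit.QuantumFields.YangMills.BalabanUVNodes.N15KingModelRung.CombesThomas

end
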